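import Literature.Probability.Process.ItoCalculusProofs
import Literature.Probability.Process.ItoIntegralConstruction
import Literature.Probability.Process.UCPLimit
import HarnessLib

/-!
# Construction of the Itô integral, II: the integral of a continuous adapted integrand

For an integrand `σ` on the canonical space which is adapted to the raw Brownian filtration,
jointly measurable and has a.s. continuous paths, the elementary integrals of its dyadic samples
(`SimpleProcess.sample`, part I) converge uniformly on compacts in probability; the limit `J` is the
Itô integral `∫₀ σ dB` in the sense of `Literature.Probability.Process.IsItoIntegral` as soon as it is a local martingale,
which we establish — under a square-integrable domination of `σ` on compacts — in the strong form
"`J` is a square-integrable martingale" (`Literature.Probability.Process.exists_isItoIntegral_of_continuous`).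

Steps:
* `isApproxSeq_sample` — the samples approximate `σ` in `L²_loc(ds)` in probability
  (pathwise convergence of part I + dominated convergence of indicators);
* `cauchy_integral_sample` — their elementary integrals are Cauchy u.c.p. (basic estimate
  `measure_sup_integral_sub_ge_le_brownian` of `ItoCalculusProofs`);
* `exists_tendstoUCP_of_cauchy` (file `UCPLimit`) gives the adapted a.s.-continuous limit `J`;
* under domination, `J t` is the `L²` limit of the elementary integrals (Fatou along the a.s.
  convergent subsequence) and hence a martingale (set integrals pass to the limit);
* the `∀ approximating sequence` clause is `tendstoUCP_of_isApproxSeq_brownian`.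

## References

* D. Revuz, M. Yor, *Continuous Martingales and Brownian Motion* (3rd ed., 1999), Ch. IV,
  Thm (2.2) (isometry), Def. (2.3) and the elementary stochastic integral following it,
  Thm (2.12) (convergence in probability uniformly on compacts), Prop. (2.13) (Riemann sums
  `∑ K_{tᵢ}(X_{tᵢ₊₁} - X_{tᵢ})` of a left-continuous locally bounded `K` converge in probability to
  `∫ K dX`).
* K. Itô, *Stochastic integral*, Proc. Imp. Acad. Tokyo 20 (1944).
-/

open MeasureTheory ProbabilityTheory Filter Finset
open scoped NNReal ENNReal Topology

noncomputable section

namespace Literature.Probability.Process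

variable {σ : ℝ≥0 → (ℝ≥0 → ℝ) → ℝ}

/-! ### Step A: the samples approximate `σ` -/

/-- Sections of a jointly measurable integrand are time-measurable. [folklore] -/
theorem measurable_section_toNNReal (hσm : Measurable (Function.uncurry σ)) (ω : ℝ≥0 → ℝ) :
    Measurable fun s : ℝ ↦ σ s.toNNReal ω :=
  hσm.comp (measurable_real_toNNReal.prodMk measurable_const)

/-- The sampling-error time integral `ω ↦ ∫₀ᵗ (σₙ(s⁺, ω) - σ(s⁺, ω))² ds` is measurable.
[folklore] -/
theorem measurable_lintegral_sample_sub_sq (hσa : Adapted RandomPlanarGeometry.brownianFiltration σ)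
    (hσm : Measurable (Function.uncurry σ)) (n : ℕ) (t : ℝ≥0) :
    Measurable fun ω ↦ ∫⁻ s in Set.Icc (0 : ℝ) t, ENNReal.ofReal
      (((SimpleProcess.sample σ hσa n).toProcess s.toNNReal ω - σ s.toNNReal ω) ^ 2) := by
  have h : Measurable fun p : (ℝ≥0 → ℝ) × ℝ ↦ ENNReal.ofReal
      (((SimpleProcess.sample σ hσa n).toProcess p.2.toNNReal p.1 - σ p.2.toNNReal p.1) ^ 2) :=
    (((SimpleProcess.sample σ hσa n).measurable_toProcess_prod.sub
      (hσm.comp ((measurable_real_toNNReal.comp measurable_snd).prodMk measurable_fst))).pow_const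
        2).ennreal_ofReal
  exact h.lintegral_prod_right'

/-- **The dyadic samples approximate a continuous adapted integrand** in `L²_loc(ds)` in
probability (`SimpleProcess.IsApproxSeq`).
Revuz–Yor, *Continuous Martingales and Brownian Motion* (1999), Ch. IV, proof of Prop. (2.13).
[folklore] -/
theorem isApproxSeq_sample (hσa : Adapted RandomPlanarGeometry.brownianFiltration σ)
    (hσm : Measurable (Function.uncurry σ))
    (hσc : ∀ᵐ ω ∂preWienerMeasure, Continuous (σ · ω)) :
    SimpleProcess.IsApproxSeq (fun n ↦ SimpleProcess.sample σ hσa n) σ preWienerMeasure := by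
  haveI := RandomPlanarGeometry.isProbabilityMeasure_preWienerMeasure'
  intro t ε hε
  refine tendsto_measure_of_ae_eventually_notMem
    (fun n ↦ measurableSet_le measurable_const (measurable_lintegral_sample_sub_sq hσa hσm n t)) ?_
  filter_upwards [hσc] with ω hω
  have h := SimpleProcess.tendsto_lintegral_sample_sub_sq σ hσa hω t
  have hev := (ENNReal.tendsto_nhds_zero.1 h) (ENNReal.ofReal (ε / 2))
    (ENNReal.ofReal_pos.2 (by positivity))
  filter_upwards [hev] with n hn hmem
  have hlt : ENNReal.ofReal (ε / 2) < ENNReal.ofReal ε :=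
    (ENNReal.ofReal_lt_ofReal_iff hε).2 (by linarith)
  exact absurd (hmem.trans hn) (not_le.2 hlt)

/-! ### Step B: the elementary integrals of the samples are Cauchy u.c.p. -/

/-- **The elementary integrals of the samples are Cauchy uniformly on compacts in probability.**
Revuz–Yor, *Continuous Martingales and Brownian Motion* (1999), Ch. IV, Thm (2.12) and
Prop. (2.13). [folklore] -/
theorem cauchy_integral_sample (hσa : Adapted RandomPlanarGeometry.brownianFiltration σ)
    (hσm : Measurable (Function.uncurry σ))
    (hσc : ∀ᵐ ω ∂preWienerMeasure, Continuous (σ · ω))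
    (t : ℝ≥0) (ε : ℝ) (hε : 0 < ε) (δ : ℝ≥0∞) (hδ : 0 < δ) :
    ∃ N, ∀ n ≥ N, ∀ n' ≥ N, preWienerMeasure {ω | ∃ s ≤ t,
      ε ≤ |(SimpleProcess.sample σ hσa n).integral brownian s ω -
        (SimpleProcess.sample σ hσa n').integral brownian s ω|} ≤ δ := by
  -- split `δ` in three
  set δ3 : ℝ≥0∞ := δ / 3 with hδ3
  have hδ3pos : 0 < δ3 := ENNReal.div_pos hδ.ne' ENNReal.ofNat_ne_top
  -- the level `η` with `η / ε² ≤ δ/3`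
  obtain ⟨η, hη, hηδ⟩ : ∃ η : ℝ, 0 < η ∧ ENNReal.ofReal (η / ε ^ 2) ≤ δ3 := by
    by_cases htop : δ3 = ⊤
    · exact ⟨1, one_pos, htop ▸ le_top⟩
    · refine ⟨δ3.toReal * ε ^ 2, ?_, ?_⟩
      · have : 0 < δ3.toReal := ENNReal.toReal_pos hδ3pos.ne' htop
        positivity
      · rw [mul_div_assoc, div_self (by positivity), mul_one, ENNReal.ofReal_toReal htop]
  have hA := isApproxSeq_sample hσa hσm hσc t (η / 4) (by positivity)
  rw [ENNReal.tendsto_nhds_zero] at hA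
  obtain ⟨N, hN⟩ := eventually_atTop.1 (hA δ3 hδ3pos)
  refine ⟨N, fun n hn n' hn' ↦ ?_⟩
  have hσ' : ∀ᵐ ω ∂preWienerMeasure, Measurable fun s : ℝ ↦ σ s.toNNReal ω :=
    ae_of_all _ (measurable_section_toNNReal hσm)
  refine (measure_sup_integral_sub_ge_le_brownian _ _ hσ' hε hη t).trans ?_
  calc _ ≤ δ3 + δ3 + δ3 := add_le_add (add_le_add (hN n hn) (hN n' hn')) hηδ
    _ = δ := by rw [hδ3, ENNReal.add_thirds]

/-! ### Step C: the u.c.p. limit -/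

/-- **The u.c.p. limit of the elementary integrals of the samples**: a strongly adapted process
`J` with a.s. continuous paths and `J 0 = 0`, which is the u.c.p. limit of the elementary
integrals of the dyadic samples of `σ` and, almost surely, their locally uniform limit along a
subsequence.
Revuz–Yor, *Continuous Martingales and Brownian Motion* (1999), Ch. IV, Thm (2.12),
Prop. (2.13). [folklore] -/
theorem exists_ucp_limit_integral_sample (hσa : Adapted RandomPlanarGeometry.brownianFiltration σ)
    (hσm : Measurable (Function.uncurry σ))
    (hσc : ∀ᵐ ω ∂preWienerMeasure, Continuous (σ · ω)) :
    ∃ J : ℝ≥0 → (ℝ≥0 → ℝ) → ℝ, StronglyAdapted RandomPlanarGeometry.brownianFiltration J ∧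
      (∀ᵐ ω ∂preWienerMeasure, Continuous (J · ω)) ∧ (∀ ω, J 0 ω = 0) ∧
      TendstoUCP (fun n ↦ (SimpleProcess.sample σ hσa n).integral brownian) J preWienerMeasure ∧
      ∃ φ : ℕ → ℕ, StrictMono φ ∧ ∀ᵐ ω ∂preWienerMeasure, ∀ t : ℝ≥0,
        TendstoUniformlyOn (fun k s ↦ (SimpleProcess.sample σ hσa (φ k)).integral brownian s ω)
          (J · ω) atTop (Set.Iic t) := by
  haveI := RandomPlanarGeometry.isProbabilityMeasure_preWienerMeasure'
  obtain ⟨J, hJa, hJc, hJ0, hJucp, φ, hφ, hJφ⟩ := exists_tendstoUCP_of_cauchy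
    (Y := fun n ↦ (SimpleProcess.sample σ hσa n).integral brownian)
    (𝓕 := RandomPlanarGeometry.brownianFiltration) (P := preWienerMeasure)
    (fun n ↦ (martingale_integral_brownian _).stronglyAdapted)
    (fun n ω ↦ (SimpleProcess.sample σ hσa n).continuous_integral (continuous_brownian ω))
    (cauchy_integral_sample hσa hσm hσc)
  exact ⟨J, hJa, hJc, fun ω ↦ hJ0 ω fun n ↦ SimpleProcess.integral_zero _ _ ω, hJucp, φ, hφ, hJφ⟩

/-! ### Step M: square-integrable domination ⇒ `L²` convergence and the martingale property -/

section Domination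

/-- The sampled step process is dominated on `[0, t]` by any bound of `|σ|` on `[0, t]`:
`|σₙ(s, ω)| ≤ M` for `s ≤ t` whenever `|σ(u, ω)| ≤ M` for all `u ≤ t` (with `M ≥ 0`). [folklore] -/
theorem abs_toProcess_sample_le_of_bound (hσa : Adapted RandomPlanarGeometry.brownianFiltration σ) {n : ℕ} {t : ℝ≥0}
    {ω : ℝ≥0 → ℝ} {M : ℝ} (hM : 0 ≤ M) (hb : ∀ u ≤ t, |σ u ω| ≤ M) {s : ℝ≥0} (hs : s ≤ t) :
    |(SimpleProcess.sample σ hσa n).toProcess s ω| ≤ M := by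
  rcases eq_or_lt_of_le (zero_le : 0 ≤ s) with hs0 | hs0
  · rw [← hs0, SimpleProcess.toProcess_zero]; simpa using hM
  by_cases hsn : s ≤ n
  · exact (SimpleProcess.abs_toProcess_sample_le σ hσa hs0 hsn ω).trans
      (hb _ ((sampleLeft_le hs0).trans hs))
  · -- beyond the grid the sampled process vanishes
    push Not at hsn
    rw [SimpleProcess.toProcess_eq_zero_of_forall]
    · simpa using hM
    · intro i hi hmem
      have hlen : (SimpleProcess.sample σ hσa n).times.length = n * 2 ^ n + 1 := by simp
      rw [hlen] at hi
      rw [SimpleProcess.sample_time σ hσa n (k := i) (by omega),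
        SimpleProcess.sample_time σ hσa n (k := i + 1) (by omega)] at hmem
      have : (((i + 1 : ℕ) : ℝ≥0) / 2 ^ n : ℝ≥0) ≤ n := by
        rw [div_le_iff₀ (pow_pos two_pos n)]
        have : ((i + 1 : ℕ) : ℝ≥0) ≤ ((n * 2 ^ n : ℕ) : ℝ≥0) := by exact_mod_cast (by omega)
        simpa using this
      exact absurd (hmem.2.trans this) (not_le.2 hsn)

/-- The sampling error on `[0, t]`, as a real time integral `gₙ(ω) = ∫₀ᵗ (σₙ - σ)² ds`, is at
most `4 t M²` under a bound `|σ(·, ω)| ≤ M` on `[0, t]`. [folklore] -/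
theorem setIntegral_sample_sub_sq_le (hσa : Adapted RandomPlanarGeometry.brownianFiltration σ)
    (hσm : Measurable (Function.uncurry σ)) {n : ℕ} {t : ℝ≥0} {ω : ℝ≥0 → ℝ} {M : ℝ}
    (hb : ∀ u ≤ t, |σ u ω| ≤ M) :
    ∫ s in Set.Icc (0 : ℝ) t,
      ((SimpleProcess.sample σ hσa n).toProcess s.toNNReal ω - σ s.toNNReal ω) ^ 2 ≤
        4 * t * M ^ 2 := by
  have hM : 0 ≤ M := (abs_nonneg _).trans (hb 0 zero_le)
  have hpt : ∀ s ∈ Set.Icc (0 : ℝ) t,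
      ((SimpleProcess.sample σ hσa n).toProcess s.toNNReal ω - σ s.toNNReal ω) ^ 2 ≤
        (2 * M) ^ 2 := by
    intro s hs
    have hst : s.toNNReal ≤ t := Real.toNNReal_le_iff_le_coe.2 hs.2
    have h1 := abs_toProcess_sample_le_of_bound hσa (n := n) hM hb hst
    have h2 := hb _ hst
    have h3 : |(SimpleProcess.sample σ hσa n).toProcess s.toNNReal ω - σ s.toNNReal ω| ≤ 2 * M :=
      (abs_sub _ _).trans (by linarith)
    nlinarith [abs_nonneg ((SimpleProcess.sample σ hσa n).toProcess s.toNNReal ω - σ s.toNNReal ω),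
      sq_abs ((SimpleProcess.sample σ hσa n).toProcess s.toNNReal ω - σ s.toNNReal ω)]
  have hmeas : Measurable fun s : ℝ ↦
      ((SimpleProcess.sample σ hσa n).toProcess s.toNNReal ω - σ s.toNNReal ω) ^ 2 :=
    (((SimpleProcess.sample σ hσa n).measurable_toProcess_prod.comp
      (measurable_const.prodMk measurable_id)).sub
      (measurable_section_toNNReal hσm ω)).pow_const 2
  have hconst : IntegrableOn (fun _ : ℝ ↦ (2 * M) ^ 2) (Set.Icc (0 : ℝ) t) :=
    integrableOn_const (hs := measure_Icc_lt_top.ne)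
  calc ∫ s in Set.Icc (0 : ℝ) t,
        ((SimpleProcess.sample σ hσa n).toProcess s.toNNReal ω - σ s.toNNReal ω) ^ 2
      ≤ ∫ _ in Set.Icc (0 : ℝ) t, (2 * M) ^ 2 := by
        refine setIntegral_mono_on ?_ hconst measurableSet_Icc hpt
        exact Integrable.mono' hconst hmeas.aestronglyMeasurable
          ((ae_restrict_iff' measurableSet_Icc).2 (ae_of_all _ fun s hs ↦ by
            rw [Real.norm_eq_abs, abs_of_nonneg (sq_nonneg _)]; exact hpt s hs))
    _ = 4 * t * M ^ 2 := by
        rw [setIntegral_const, Real.volume_real_Icc_of_le (by positivity), sub_zero, smul_eq_mul]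
        ring

/-- The sampling error `gₙ(ω) = ∫₀ᵗ (σₙ - σ)² ds` tends to `0` for paths where `σ` is continuous
(real-integral form of `tendsto_lintegral_sample_sub_sq`). [folklore] -/
theorem tendsto_setIntegral_sample_sub_sq (hσa : Adapted RandomPlanarGeometry.brownianFiltration σ)
    (hσm : Measurable (Function.uncurry σ)) {ω : ℝ≥0 → ℝ} (hω : Continuous (σ · ω)) (t : ℝ≥0) :
    Tendsto (fun n ↦ ∫ s in Set.Icc (0 : ℝ) t,
      ((SimpleProcess.sample σ hσa n).toProcess s.toNNReal ω - σ s.toNNReal ω) ^ 2)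
      atTop (𝓝 0) := by
  have h := SimpleProcess.tendsto_lintegral_sample_sub_sq σ hσa hω t
  have heq : ∀ n, ∫ s in Set.Icc (0 : ℝ) t,
      ((SimpleProcess.sample σ hσa n).toProcess s.toNNReal ω - σ s.toNNReal ω) ^ 2 =
      (∫⁻ s in Set.Icc (0 : ℝ) t, ENNReal.ofReal
        (((SimpleProcess.sample σ hσa n).toProcess s.toNNReal ω - σ s.toNNReal ω) ^ 2)).toReal :=
    fun n ↦ integral_eq_lintegral_of_nonneg_ae (ae_of_all _ fun s ↦ sq_nonneg _)
      ((((SimpleProcess.sample σ hσa n).measurable_toProcess_prod.comp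
      (measurable_const.prodMk measurable_id)).sub
        (measurable_section_toNNReal hσm ω)).pow_const 2).aestronglyMeasurable
  simp_rw [heq]
  have h2 := (ENNReal.tendsto_toReal ENNReal.zero_ne_top).comp h
  rw [ENNReal.toReal_zero] at h2
  exact h2

/-- The sampling error `gₙ` is a measurable function of `ω`. [folklore] -/
theorem stronglyMeasurable_setIntegral_sample_sub_sq (hσa : Adapted RandomPlanarGeometry.brownianFiltration σ)
    (hσm : Measurable (Function.uncurry σ)) (n : ℕ) (t : ℝ≥0) :
    StronglyMeasurable fun ω ↦ ∫ s in Set.Icc (0 : ℝ) t,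
      ((SimpleProcess.sample σ hσa n).toProcess s.toNNReal ω - σ s.toNNReal ω) ^ 2 := by
  have h : StronglyMeasurable fun p : (ℝ≥0 → ℝ) × ℝ ↦
      ((SimpleProcess.sample σ hσa n).toProcess p.2.toNNReal p.1 - σ p.2.toNNReal p.1) ^ 2 :=
    (((SimpleProcess.sample σ hσa n).measurable_toProcess_prod.sub
      (hσm.comp ((measurable_real_toNNReal.comp measurable_snd).prodMk measurable_fst))).pow_const
        2).stronglyMeasurable
  exact h.integral_prod_right' (ν := volume.restrict (Set.Icc (0 : ℝ) t))

/-- **The expected sampling error tends to zero**: `E ∫₀ᵗ (σₙ - σ)² ds → 0` (dominated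
convergence, domination `4 t M²`).
Revuz–Yor, *Continuous Martingales and Brownian Motion* (1999), Ch. IV, proof of Prop. (2.13)
(bounded convergence in `L²(M)`). [folklore] -/
theorem tendsto_integral_setIntegral_sample_sub_sq (hσa : Adapted RandomPlanarGeometry.brownianFiltration σ)
    (hσm : Measurable (Function.uncurry σ))
    (hσc : ∀ᵐ ω ∂preWienerMeasure, Continuous (σ · ω))
    (hdom : ∀ t : ℝ≥0, ∃ M : (ℝ≥0 → ℝ) → ℝ, MemLp M 2 preWienerMeasure ∧
      ∀ᵐ ω ∂preWienerMeasure, ∀ s ≤ t, |σ s ω| ≤ M ω) (t : ℝ≥0) :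
    Tendsto (fun n ↦ ∫ ω, (∫ s in Set.Icc (0 : ℝ) t,
      ((SimpleProcess.sample σ hσa n).toProcess s.toNNReal ω - σ s.toNNReal ω) ^ 2)
        ∂preWienerMeasure) atTop (𝓝 0) := by
  obtain ⟨M, hM2, hMb⟩ := hdom t
  have h := tendsto_integral_of_dominated_convergence (μ := preWienerMeasure)
    (F := fun n ω ↦ ∫ s in Set.Icc (0 : ℝ) t,
      ((SimpleProcess.sample σ hσa n).toProcess s.toNNReal ω - σ s.toNNReal ω) ^ 2)
    (f := fun _ ↦ (0 : ℝ)) (fun ω ↦ 4 * t * M ω ^ 2)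
    (fun n ↦ (stronglyMeasurable_setIntegral_sample_sub_sq hσa hσm n t).aestronglyMeasurable)
    (hM2.integrable_sq.const_mul (4 * t))
    (fun n ↦ by
      filter_upwards [hMb] with ω hω
      rw [Real.norm_eq_abs, abs_of_nonneg (integral_nonneg fun s ↦ sq_nonneg _)]
      exact setIntegral_sample_sub_sq_le hσa hσm hω)
    (by filter_upwards [hσc] with ω hω using tendsto_setIntegral_sample_sub_sq hσa hσm hω t)
  simpa using h

/-- The sampling errors are integrable (dominated by `4 t M²`). [folklore] -/
theorem integrable_setIntegral_sample_sub_sq (hσa : Adapted RandomPlanarGeometry.brownianFiltration σ)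
    (hσm : Measurable (Function.uncurry σ))
    (hdom : ∀ t : ℝ≥0, ∃ M : (ℝ≥0 → ℝ) → ℝ, MemLp M 2 preWienerMeasure ∧
      ∀ᵐ ω ∂preWienerMeasure, ∀ s ≤ t, |σ s ω| ≤ M ω) (n : ℕ) (t : ℝ≥0) :
    Integrable (fun ω ↦ ∫ s in Set.Icc (0 : ℝ) t,
      ((SimpleProcess.sample σ hσa n).toProcess s.toNNReal ω - σ s.toNNReal ω) ^ 2)
        preWienerMeasure := by
  obtain ⟨M, hM2, hMb⟩ := hdom t
  refine Integrable.mono' (hM2.integrable_sq.const_mul (4 * t))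
    (stronglyMeasurable_setIntegral_sample_sub_sq hσa hσm n t).aestronglyMeasurable ?_
  filter_upwards [hMb] with ω hω
  rw [Real.norm_eq_abs, abs_of_nonneg (integral_nonneg fun s ↦ sq_nonneg _)]
  exact setIntegral_sample_sub_sq_le hσa hσm hω

/-- The time integral of the squared step process is an integrable random variable. [folklore] -/
theorem integrable_setIntegral_toProcess_sq
    (H : SimpleProcess (inferInstance : MeasurableSpace (ℝ≥0 → ℝ)) RandomPlanarGeometry.brownianFiltration) (t : ℝ≥0) :
    Integrable (fun ω ↦ ∫ s in Set.Icc (0 : ℝ) t, (H.toProcess s.toNNReal ω) ^ 2)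
      preWienerMeasure := by
  simp_rw [H.setIntegral_toProcess_sq]
  exact integrable_finsetSum _ fun i hi ↦
    (integrable_value_sq_brownian H (by have := Finset.mem_range.1 hi; omega)).mul_const _

/-- On a path where `σ` is continuous, `s ↦ (H(s⁺) - σ(s⁺))²` is integrable on `[0, t]` for any
bounded simple `H` (bounded measurable integrand on a finite interval). [folklore] -/
theorem integrableOn_toProcess_sub_sq
    (H : SimpleProcess (inferInstance : MeasurableSpace (ℝ≥0 → ℝ)) RandomPlanarGeometry.brownianFiltration)
    (hσm : Measurable (Function.uncurry σ)) {ω : ℝ≥0 → ℝ} (hω : Continuous (σ · ω)) (t : ℝ≥0) :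
    IntegrableOn (fun s : ℝ ↦ (H.toProcess s.toNNReal ω - σ s.toNNReal ω) ^ 2)
      (Set.Icc (0 : ℝ) t) := by
  obtain ⟨C, hC⟩ := H.bounded
  obtain ⟨B, hB⟩ := (isCompact_Icc (a := (0 : ℝ≥0)) (b := t)).exists_bound_of_continuousOn
    hω.continuousOn
  have hmeas : Measurable fun s : ℝ ↦ (H.toProcess s.toNNReal ω - σ s.toNNReal ω) ^ 2 :=
    ((H.measurable_toProcess_prod.comp (measurable_const.prodMk measurable_id)).sub (measurable_section_toNNReal hσm ω)).pow_const 2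
  have hconst : IntegrableOn (fun _ : ℝ ↦ (max C 0 + B) ^ 2) (Set.Icc (0 : ℝ) t) :=
    integrableOn_const (hs := measure_Icc_lt_top.ne)
  refine Integrable.mono' hconst hmeas.aestronglyMeasurable
    ((ae_restrict_iff' measurableSet_Icc).2 (ae_of_all _ fun s hs ↦ ?_))
  have h1 : |H.toProcess s.toNNReal ω| ≤ max C 0 := H.abs_toProcess_le hC _ ω
  have h2 : |σ s.toNNReal ω| ≤ B := by
    have := hB s.toNNReal ⟨zero_le, Real.toNNReal_le_iff_le_coe.2 hs.2⟩
    rwa [Real.norm_eq_abs] at this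
  rw [Real.norm_eq_abs, abs_of_nonneg (sq_nonneg _)]
  have h3 : |H.toProcess s.toNNReal ω - σ s.toNNReal ω| ≤ max C 0 + B :=
    (abs_sub _ _).trans (add_le_add h1 h2)
  have h4 : 0 ≤ max C 0 + B := (abs_nonneg _).trans h3
  nlinarith [abs_nonneg (H.toProcess s.toNNReal ω - σ s.toNNReal ω),
    sq_abs (H.toProcess s.toNNReal ω - σ s.toNNReal ω)]

/-- **Pathwise comparison of the difference of two simple processes with their distances to a
common target**: `∫₀ᵗ (H - K)² ≤ 2 ∫₀ᵗ (H - σ)² + 2 ∫₀ᵗ (K - σ)²` on paths where `σ` is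
continuous. [folklore] -/
theorem setIntegral_toProcess_sub_sq_le_two_mul
    (H K : SimpleProcess (inferInstance : MeasurableSpace (ℝ≥0 → ℝ)) RandomPlanarGeometry.brownianFiltration)
    (hσm : Measurable (Function.uncurry σ)) {ω : ℝ≥0 → ℝ} (hω : Continuous (σ · ω)) (t : ℝ≥0) :
    ∫ s in Set.Icc (0 : ℝ) t, ((H.sub K).toProcess s.toNNReal ω) ^ 2 ≤
      2 * (∫ s in Set.Icc (0 : ℝ) t, (H.toProcess s.toNNReal ω - σ s.toNNReal ω) ^ 2) +
      2 * (∫ s in Set.Icc (0 : ℝ) t, (K.toProcess s.toNNReal ω - σ s.toNNReal ω) ^ 2) := by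
  have hH := integrableOn_toProcess_sub_sq H hσm hω t
  have hK := integrableOn_toProcess_sub_sq K hσm hω t
  rw [← integral_const_mul, ← integral_const_mul, ← integral_add (hH.const_mul 2) (hK.const_mul 2)]
  refine integral_mono_of_nonneg (ae_of_all _ fun s ↦ sq_nonneg _)
    ((hH.const_mul 2).add (hK.const_mul 2)) (ae_of_all _ fun s ↦ ?_)
  dsimp only
  rw [H.toProcess_sub K]
  nlinarith [sq_nonneg (H.toProcess s.toNNReal ω + K.toProcess s.toNNReal ω -
    2 * σ s.toNNReal ω)]

/-- **The elementary integrals of the samples are Cauchy in `L²` at each time**: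
`E[((σₙ · B)ₜ - (σₘ · B)ₜ)²] ≤ 2 E∫₀ᵗ(σₙ - σ)² + 2 E∫₀ᵗ(σₘ - σ)²` (Itô isometry for the simple
process `σₙ - σₘ`).
Revuz–Yor, *Continuous Martingales and Brownian Motion* (1999), Ch. IV, Thm (2.2) (isometry) and
proof of Prop. (2.13). [folklore] -/
theorem integral_integral_sample_sub_sq_le (hσa : Adapted RandomPlanarGeometry.brownianFiltration σ)
    (hσm : Measurable (Function.uncurry σ))
    (hσc : ∀ᵐ ω ∂preWienerMeasure, Continuous (σ · ω))
    (hdom : ∀ t : ℝ≥0, ∃ M : (ℝ≥0 → ℝ) → ℝ, MemLp M 2 preWienerMeasure ∧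
      ∀ᵐ ω ∂preWienerMeasure, ∀ s ≤ t, |σ s ω| ≤ M ω) (n n' : ℕ) (t : ℝ≥0) :
    ∫ ω, ((SimpleProcess.sample σ hσa n).integral brownian t ω -
      (SimpleProcess.sample σ hσa n').integral brownian t ω) ^ 2 ∂preWienerMeasure ≤
      2 * ∫ ω, (∫ s in Set.Icc (0 : ℝ) t,
        ((SimpleProcess.sample σ hσa n).toProcess s.toNNReal ω - σ s.toNNReal ω) ^ 2)
          ∂preWienerMeasure +
      2 * ∫ ω, (∫ s in Set.Icc (0 : ℝ) t,
        ((SimpleProcess.sample σ hσa n').toProcess s.toNNReal ω - σ s.toNNReal ω) ^ 2)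
          ∂preWienerMeasure := by
  set L := SimpleProcess.sample σ hσa n with hL
  set L' := SimpleProcess.sample σ hσa n' with hL'
  have hsub : ∀ ω, (L.integral brownian t ω - L'.integral brownian t ω) ^ 2 =
      ((L.sub L').integral brownian t ω) ^ 2 := fun ω ↦ by rw [L.integral_sub L']
  simp_rw [hsub]
  rw [itoIsometry_simple_holds (L.sub L') t, ← integral_const_mul, ← integral_const_mul,
    ← integral_add ((integrable_setIntegral_sample_sub_sq hσa hσm hdom n t).const_mul 2)
      ((integrable_setIntegral_sample_sub_sq hσa hσm hdom n' t).const_mul 2)]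
  refine integral_mono_ae (integrable_setIntegral_toProcess_sq (L.sub L') t)
    (((integrable_setIntegral_sample_sub_sq hσa hσm hdom n t).const_mul 2).add
      ((integrable_setIntegral_sample_sub_sq hσa hσm hdom n' t).const_mul 2)) ?_
  filter_upwards [hσc] with ω hω
  exact setIntegral_toProcess_sub_sq_le_two_mul L L' hσm hω t

end Domination

/-! ### The Itô integral of a continuous adapted dominated integrand -/

/-- Elementary: `|x| ≤ a/2 + x²/(2a)` for `a > 0`, in `ℝ≥0∞` form. [folklore] -/
theorem ofReal_abs_le_add_sq {a : ℝ} (ha : 0 < a) (x : ℝ) :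
    ENNReal.ofReal |x| ≤ ENNReal.ofReal (a / 2) + ENNReal.ofReal (1 / (2 * a)) * ENNReal.ofReal (x ^ 2) := by
  rw [← ENNReal.ofReal_mul (by positivity), ← ENNReal.ofReal_add (by positivity) (by positivity)]
  refine ENNReal.ofReal_le_ofReal ?_
  rw [one_div, inv_mul_eq_div]
  have h : 0 ≤ (|x| - a) ^ 2 := sq_nonneg _
  rw [sub_sq, sq_abs] at h
  rw [div_add_div _ _ (two_ne_zero) (by positivity), le_div_iff₀ (by positivity)]
  nlinarith [abs_nonneg x]

/-- For every positive `ε' ∈ ℝ≥0∞` there is a real `e > 0` with `ofReal (√e) ≤ ε'`. [folklore] -/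
theorem exists_pos_ofReal_sqrt_le {ε' : ℝ≥0∞} (hε' : 0 < ε') :
    ∃ e : ℝ, 0 < e ∧ ENNReal.ofReal (Real.sqrt e) ≤ ε' := by
  by_cases htop : ε' = ⊤
  · exact ⟨1, one_pos, htop ▸ le_top⟩
  have hpos : 0 < ε'.toReal := ENNReal.toReal_pos hε'.ne' htop
  refine ⟨ε'.toReal ^ 2, by positivity, ?_⟩
  rw [Real.sqrt_sq hpos.le, ENNReal.ofReal_toReal htop]

/-- **The Itô integral of a continuous adapted integrand** (raw Brownian filtration, canonical
space). Let `σ` be adapted to `brownianFiltration`, jointly measurable, with a.s. continuous paths,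
and dominated on compacts by square-integrable random variables (`|σ_s| ≤ M_t ∈ L²` for `s ≤ t`,
a.s.). Then the elementary integrals of the dyadic samples of `σ` converge uniformly on compacts in
probability and in `L²` at each time to a process `J` which **is the Itô integral `∫₀ σ dB` in the
sense of `IsItoIntegral`**, and which is moreover a square-integrable martingale for the raw
Brownian filtration (so that the local-martingale conjunct holds with the constant localising
sequence).
Itô (1944); Revuz–Yor, *Continuous Martingales and Brownian Motion* (1999), Ch. IV, Thm (2.2),
Def. (2.3), Thm (2.12), Prop. (2.13) (raw-filtration version, cf. the '?' caveat of
`Literature.Probability.Process.exists_isItoIntegral`). [folklore] -/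
theorem exists_isItoIntegral_of_continuous (hσa : Adapted RandomPlanarGeometry.brownianFiltration σ)
    (hσm : Measurable (Function.uncurry σ))
    (hσc : ∀ᵐ ω ∂preWienerMeasure, Continuous (σ · ω))
    (hdom : ∀ t : ℝ≥0, ∃ M : (ℝ≥0 → ℝ) → ℝ, MemLp M 2 preWienerMeasure ∧
      ∀ᵐ ω ∂preWienerMeasure, ∀ s ≤ t, |σ s ω| ≤ M ω) :
    ∃ J : ℝ≥0 → (ℝ≥0 → ℝ) → ℝ,
      IsItoIntegral σ brownian J RandomPlanarGeometry.brownianFiltration preWienerMeasure ∧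
      Martingale J RandomPlanarGeometry.brownianFiltration preWienerMeasure ∧
      (∀ t, MemLp (J t) 2 preWienerMeasure) ∧
      TendstoUCP (fun n ↦ (SimpleProcess.sample σ hσa n).integral brownian) J preWienerMeasure ∧
      ∀ t : ℝ≥0, ∀ e : ℝ, 0 < e → ∃ N, ∀ n ≥ N,
        ∫⁻ ω, ENNReal.ofReal (((SimpleProcess.sample σ hσa n).integral brownian t ω - J t ω) ^ 2)
          ∂preWienerMeasure ≤ ENNReal.ofReal e := by
  haveI := RandomPlanarGeometry.isProbabilityMeasure_preWienerMeasure'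
  obtain ⟨J, hJa, hJc, hJ0, hJucp, φ, hφ, hJφ⟩ := exists_ucp_limit_integral_sample hσa hσm hσc
  set Y : ℕ → ℝ≥0 → (ℝ≥0 → ℝ) → ℝ := fun n ↦ (SimpleProcess.sample σ hσa n).integral brownian
    with hY
  have hYL2 : ∀ n t, MemLp (Y n t) 2 preWienerMeasure := fun n t ↦ memLp_two_integral_brownian _ t
  -- Step 1: Cauchy in `L²` at each time
  have hcauchyL2 : ∀ (t : ℝ≥0) (e : ℝ), 0 < e → ∃ N, ∀ n ≥ N, ∀ n' ≥ N,
      ∫ ω, (Y n t ω - Y n' t ω) ^ 2 ∂preWienerMeasure ≤ e := by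
    intro t e he
    have h := tendsto_integral_setIntegral_sample_sub_sq hσa hσm hσc hdom t
    obtain ⟨N, hN⟩ := (Metric.tendsto_atTop.1 h) (e / 4) (by positivity)
    refine ⟨N, fun n hn n' hn' ↦ ?_⟩
    have h1 := hN n hn
    have h2 := hN n' hn'
    rw [Real.dist_eq, sub_zero, abs_of_nonneg (integral_nonneg fun ω ↦
      integral_nonneg fun s ↦ sq_nonneg _)] at h1 h2
    have := integral_integral_sample_sub_sq_le hσa hσm hσc hdom n n' t
    linarith
  -- Step 2: Fatou along the a.s. convergent subsequence
  have hfatou : ∀ (t : ℝ≥0) (e : ℝ), 0 < e → ∃ N, ∀ n ≥ N,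
      ∫⁻ ω, ENNReal.ofReal ((Y n t ω - J t ω) ^ 2) ∂preWienerMeasure ≤ ENNReal.ofReal e := by
    intro t e he
    obtain ⟨N, hN⟩ := hcauchyL2 t e he
    refine ⟨N, fun n hn ↦ ?_⟩
    have hpt : ∀ᵐ ω ∂preWienerMeasure, Tendsto (fun k ↦ Y (φ k) t ω) atTop (𝓝 (J t ω)) := by
      filter_upwards [hJφ] with ω hω
      exact (hω t).tendsto_at (Set.mem_Iic.2 le_rfl)
    have hlim : ∀ᵐ ω ∂preWienerMeasure,
        liminf (fun k ↦ ENNReal.ofReal ((Y n t ω - Y (φ k) t ω) ^ 2)) atTop =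
          ENNReal.ofReal ((Y n t ω - J t ω) ^ 2) := by
      filter_upwards [hpt] with ω hω
      refine Tendsto.liminf_eq ?_
      exact (ENNReal.continuous_ofReal.tendsto _).comp
        (((continuous_const.sub continuous_id).pow 2).tendsto _ |>.comp hω)
    calc ∫⁻ ω, ENNReal.ofReal ((Y n t ω - J t ω) ^ 2) ∂preWienerMeasure
        = ∫⁻ ω, liminf (fun k ↦ ENNReal.ofReal ((Y n t ω - Y (φ k) t ω) ^ 2)) atTop
            ∂preWienerMeasure := lintegral_congr_ae (hlim.mono fun ω hω ↦ hω.symm)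
      _ ≤ liminf (fun k ↦ ∫⁻ ω, ENNReal.ofReal ((Y n t ω - Y (φ k) t ω) ^ 2) ∂preWienerMeasure)
            atTop :=
          lintegral_liminf_le' fun k ↦ (AEMeasurable.pow_const (f := fun ω ↦ Y n t ω - Y (φ k) t ω)
            ((hYL2 n t).1.aemeasurable.sub (hYL2 (φ k) t).1.aemeasurable) 2).ennreal_ofReal
      _ ≤ ENNReal.ofReal e := by
          refine liminf_le_of_frequently_le' (Eventually.frequently ?_)
          refine eventually_atTop.2 ⟨N, fun k hk ↦ ?_⟩
          have hint : Integrable (fun ω ↦ (Y n t ω - Y (φ k) t ω) ^ 2) preWienerMeasure :=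
            ((hYL2 n t).sub (hYL2 (φ k) t)).integrable_sq
          rw [← ofReal_integral_eq_lintegral_ofReal hint (ae_of_all _ fun ω ↦ sq_nonneg _)]
          exact ENNReal.ofReal_le_ofReal (hN n hn (φ k) (hk.trans (hφ.id_le k)))
  -- Step 3: `J t ∈ L²`
  have hJm : ∀ t, AEStronglyMeasurable (J t) preWienerMeasure := fun t ↦
    ((hJa t).mono (RandomPlanarGeometry.brownianFiltration.le t)).aestronglyMeasurable
  have hDm : ∀ n t, AEMeasurable (fun ω ↦ Y n t ω - J t ω) preWienerMeasure := fun n t ↦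
    (hYL2 n t).1.aemeasurable.sub (hJm t).aemeasurable
  have hDsm : ∀ n t, AEStronglyMeasurable (fun ω ↦ Y n t ω - J t ω) preWienerMeasure := fun n t ↦
    (hYL2 n t).1.sub (hJm t)
  have hDL2 : ∀ t, ∃ N, ∀ n ≥ N, MemLp (fun ω ↦ Y n t ω - J t ω) 2 preWienerMeasure := by
    intro t
    obtain ⟨N, hN⟩ := hfatou t 1 one_pos
    refine ⟨N, fun n hn ↦ ?_⟩
    rw [memLp_two_iff_integrable_sq (hDsm n t)]
    refine ⟨((hDm n t).pow_const 2).aestronglyMeasurable, ?_⟩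
    rw [hasFiniteIntegral_iff_ofReal (ae_of_all _ fun ω ↦ sq_nonneg _)]
    exact (hN n hn).trans_lt ENNReal.ofReal_lt_top
  have hJL2 : ∀ t, MemLp (J t) 2 preWienerMeasure := by
    intro t
    obtain ⟨N, hN⟩ := hDL2 t
    have h := (hYL2 N t).sub (hN N le_rfl)
    have heq : (Y N t - fun ω ↦ Y N t ω - J t ω) = J t := by ext ω; simp
    rwa [heq] at h
  -- Step 4: `L¹` convergence `∫⁻ ‖Y n t - J t‖ₑ → 0`
  have hL1 : ∀ t, Tendsto (fun n ↦ ∫⁻ ω, ‖Y n t ω - J t ω‖ₑ ∂preWienerMeasure) atTop (𝓝 0) := by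
    intro t
    rw [ENNReal.tendsto_nhds_zero]
    intro ε' hε'
    obtain ⟨e, he, heε⟩ := exists_pos_ofReal_sqrt_le hε'
    obtain ⟨N, hN⟩ := hfatou t e he
    refine eventually_atTop.2 ⟨N, fun n hn ↦ ?_⟩
    have ha : 0 < Real.sqrt e := Real.sqrt_pos.2 he
    calc ∫⁻ ω, ‖Y n t ω - J t ω‖ₑ ∂preWienerMeasure
        = ∫⁻ ω, ENNReal.ofReal |Y n t ω - J t ω| ∂preWienerMeasure := by
          simp_rw [Real.enorm_eq_ofReal_abs]
      _ ≤ ∫⁻ ω, (ENNReal.ofReal (Real.sqrt e / 2) + ENNReal.ofReal (1 / (2 * Real.sqrt e)) *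
            ENNReal.ofReal ((Y n t ω - J t ω) ^ 2)) ∂preWienerMeasure :=
          lintegral_mono fun ω ↦ ofReal_abs_le_add_sq ha _
      _ = ENNReal.ofReal (Real.sqrt e / 2) + ENNReal.ofReal (1 / (2 * Real.sqrt e)) *
            ∫⁻ ω, ENNReal.ofReal ((Y n t ω - J t ω) ^ 2) ∂preWienerMeasure := by
          rw [lintegral_add_left measurable_const, lintegral_const, measure_univ, mul_one,
            lintegral_const_mul'' _ ((hDm n t).pow_const 2).ennreal_ofReal]
      _ ≤ ENNReal.ofReal (Real.sqrt e / 2) + ENNReal.ofReal (1 / (2 * Real.sqrt e)) *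
            ENNReal.ofReal e := by gcongr; exact hN n hn
      _ = ENNReal.ofReal (Real.sqrt e) := by
          rw [← ENNReal.ofReal_mul (by positivity), ← ENNReal.ofReal_add (by positivity)
            (by positivity)]
          congr 1
          have hs : Real.sqrt e * Real.sqrt e = e := Real.mul_self_sqrt he.le
          have : 1 / (2 * Real.sqrt e) * e = Real.sqrt e / 2 := by
            calc 1 / (2 * Real.sqrt e) * e = (Real.sqrt e * Real.sqrt e) / (2 * Real.sqrt e) := by
                  rw [hs]; ring
              _ = Real.sqrt e / 2 := by rw [mul_div_mul_right _ _ ha.ne']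
          rw [this]; ring
      _ ≤ ε' := heε
  -- Step 5: martingale property by passing to the limit in the set integrals
  have hJint : ∀ t, Integrable (J t) preWienerMeasure := fun t ↦ (hJL2 t).integrable one_le_two
  have hmart : Martingale J RandomPlanarGeometry.brownianFiltration preWienerMeasure := by
    refine ⟨hJa, fun s t hst ↦ ?_⟩
    refine (ae_eq_condExp_of_forall_setIntegral_eq (RandomPlanarGeometry.brownianFiltration.le s) (hJint t)
      (fun A _ _ ↦ (hJint s).integrableOn) (fun A hA _ ↦ ?_) (hJa s).aestronglyMeasurable).symm
    have h1 : Tendsto (fun n ↦ ∫ ω in A, Y n t ω ∂preWienerMeasure) atTop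
        (𝓝 (∫ ω in A, J t ω ∂preWienerMeasure)) :=
      tendsto_setIntegral_of_L1 (J t) (hJm t)
        (Eventually.of_forall fun n ↦ (hYL2 n t).integrable one_le_two) (hL1 t) A
    have h2 : Tendsto (fun n ↦ ∫ ω in A, Y n s ω ∂preWienerMeasure) atTop
        (𝓝 (∫ ω in A, J s ω ∂preWienerMeasure)) :=
      tendsto_setIntegral_of_L1 (J s) (hJm s)
        (Eventually.of_forall fun n ↦ (hYL2 n s).integrable one_le_two) (hL1 s) A
    have h3 : ∀ n, ∫ ω in A, Y n s ω ∂preWienerMeasure = ∫ ω in A, Y n t ω ∂preWienerMeasure :=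
      fun n ↦ (martingale_integral_brownian _).setIntegral_eq hst hA
    simp_rw [h3] at h2
    exact tendsto_nhds_unique h2 h1
  -- Step 6: assemble
  have hσ' : ∀ᵐ ω ∂preWienerMeasure, Measurable fun s : ℝ ↦ σ s.toNNReal ω :=
    ae_of_all _ (measurable_section_toNNReal hσm)
  refine ⟨J, ⟨hJ0, hJc, hmart.isLocalMartingale, ⟨fun n ↦ SimpleProcess.sample σ hσa n,
    isApproxSeq_sample hσa hσm hσc⟩, fun Hn hHn ↦
      tendstoUCP_of_isApproxSeq_brownian hσ' (isApproxSeq_sample hσa hσm hσc) hHn hJucp⟩,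
    hmart, hJL2, hJucp, hfatou⟩

/-! ### The second moment of the integral: `E[J_t²] ≤ E ∫₀ᵗ σ² ds` -/

/-- **Pointwise convergence of the dyadic samples** on a continuous path: for `s > 0`,
`σₙ(s, ω) → σ(s, ω)` (the sampling time `sampleLeft n s → s` and the clamping is eventually
inactive).
Revuz–Yor, *Continuous Martingales and Brownian Motion* (1999), Ch. IV, proof of Prop. (2.13)
("converge pointwise to `K`"). [folklore] -/
theorem tendsto_toProcess_sample (hσa : Adapted RandomPlanarGeometry.brownianFiltration σ) {ω : ℝ≥0 → ℝ}
    (hω : Continuous (σ · ω)) {s : ℝ≥0} (hs0 : 0 < s) :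
    Tendsto (fun n ↦ (SimpleProcess.sample σ hσa n).toProcess s ω) atTop (𝓝 (σ s ω)) := by
  -- the sampling times converge to `s`
  have hleft : Tendsto (fun n ↦ sampleLeft n s) atTop (𝓝 s) := by
    rw [Metric.tendsto_atTop]
    intro ε hε
    obtain ⟨N, hN⟩ := exists_pow_lt_of_lt_one hε (by norm_num : (1 / 2 : ℝ) < 1)
    refine ⟨N, fun n hn ↦ ?_⟩
    obtain ⟨h1, h2⟩ := sampleLeft_le_and_sub_le (n := n) hs0
    rw [NNReal.dist_eq, abs_sub_comm, abs_of_nonneg (by rw [sub_nonneg]; exact_mod_cast h1)]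
    calc (s : ℝ) - sampleLeft n s ≤ 1 / 2 ^ n := h2
      _ ≤ 1 / 2 ^ N := one_div_le_one_div_of_le (pow_pos two_pos _)
          (pow_le_pow_right₀ one_le_two hn)
      _ = (1 / 2) ^ N := by rw [one_div, ← inv_pow, one_div]
      _ < ε := hN
  have hσconv : Tendsto (fun n ↦ σ (sampleLeft n s) ω) atTop (𝓝 (σ s ω)) :=
    (hω.tendsto s).comp hleft
  -- eventually `n ≥ s` and the clamping is inactive
  obtain ⟨C, hC⟩ : ∃ C, ∀ n, |σ (sampleLeft n s) ω| ≤ C := by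
    obtain ⟨C, hC⟩ := hσconv.abs.bddAbove_range
    exact ⟨C, fun n ↦ hC ⟨n, rfl⟩⟩
  obtain ⟨N, hN⟩ := exists_nat_ge (max (s : ℝ) C)
  refine hσconv.congr' (eventually_atTop.2 ⟨N, fun n hn ↦ ?_⟩)
  have hsn : s ≤ n := by
    have : (s : ℝ) ≤ n := (le_max_left _ _).trans (hN.trans (by exact_mod_cast hn))
    exact_mod_cast this
  show σ (sampleLeft n s) ω = (SimpleProcess.sample σ hσa n).toProcess s ω
  rw [SimpleProcess.toProcess_sample σ hσa hs0 hsn]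
  exact (clamp_eq_self ((hC n).trans ((le_max_right _ _).trans (hN.trans (by exact_mod_cast hn))))).symm

/-- **Pathwise convergence of `∫₀ᵗ σₙ² ds` to `∫₀ᵗ σ² ds`** on continuous dominated paths
(dominated convergence on `[0, t]`). [folklore] -/
theorem tendsto_setIntegral_sample_sq (hσa : Adapted RandomPlanarGeometry.brownianFiltration σ)
    {ω : ℝ≥0 → ℝ} (hω : Continuous (σ · ω)) {t : ℝ≥0}
    {M : ℝ} (hb : ∀ u ≤ t, |σ u ω| ≤ M) :
    Tendsto (fun n ↦ ∫ s in Set.Icc (0 : ℝ) t,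
      ((SimpleProcess.sample σ hσa n).toProcess s.toNNReal ω) ^ 2) atTop
      (𝓝 (∫ s in Set.Icc (0 : ℝ) t, (σ s.toNNReal ω) ^ 2)) := by
  have hM : 0 ≤ M := (abs_nonneg _).trans (hb 0 zero_le)
  refine tendsto_integral_of_dominated_convergence (fun _ ↦ M ^ 2)
    (fun n ↦ ((((SimpleProcess.sample σ hσa n).measurable_toProcess_prod.comp
      (measurable_const.prodMk measurable_id))).pow_const 2).aestronglyMeasurable)
    (integrableOn_const (hs := measure_Icc_lt_top.ne)) (fun n ↦ ?_) ?_
  · refine (ae_restrict_iff' measurableSet_Icc).2 (ae_of_all _ fun s hs ↦ ?_)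
    rw [Real.norm_eq_abs, abs_of_nonneg (sq_nonneg _)]
    have h := abs_toProcess_sample_le_of_bound hσa (n := n) hM hb
      (Real.toNNReal_le_iff_le_coe.2 hs.2)
    nlinarith [abs_nonneg ((SimpleProcess.sample σ hσa n).toProcess s.toNNReal ω),
      sq_abs ((SimpleProcess.sample σ hσa n).toProcess s.toNNReal ω)]
  · -- pointwise convergence off the (null) point `s = 0`
    rw [ae_restrict_iff' measurableSet_Icc]
    have h0 : ∀ᵐ s : ℝ ∂volume, s ≠ 0 := by
      rw [ae_iff]; simp
    filter_upwards [h0] with s hs0 hs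
    have hs0' : 0 < s.toNNReal := Real.toNNReal_pos.2 (lt_of_le_of_ne hs.1 (Ne.symm hs0))
    exact ((continuous_pow 2).tendsto _).comp (tendsto_toProcess_sample hσa hω hs0')

/-- **The second moments of the elementary integrals converge to `E ∫₀ᵗ σ² ds`**:
`E[(σₙ · B)ₜ²] = E ∫₀ᵗ σₙ² ds → E ∫₀ᵗ σ² ds` (Itô isometry and dominated convergence).
Revuz–Yor, *Continuous Martingales and Brownian Motion* (1999), Ch. IV, Thm (2.2). [folklore] -/
theorem tendsto_integral_integral_sample_sq (hσa : Adapted RandomPlanarGeometry.brownianFiltration σ)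
    (hσc : ∀ᵐ ω ∂preWienerMeasure, Continuous (σ · ω))
    (hdom : ∀ t : ℝ≥0, ∃ M : (ℝ≥0 → ℝ) → ℝ, MemLp M 2 preWienerMeasure ∧
      ∀ᵐ ω ∂preWienerMeasure, ∀ s ≤ t, |σ s ω| ≤ M ω) (t : ℝ≥0) :
    Tendsto (fun n ↦ ∫ ω, ((SimpleProcess.sample σ hσa n).integral brownian t ω) ^ 2
      ∂preWienerMeasure) atTop
      (𝓝 (∫ ω, (∫ s in Set.Icc (0 : ℝ) t, (σ s.toNNReal ω) ^ 2) ∂preWienerMeasure)) := by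
  obtain ⟨M, hM2, hMb⟩ := hdom t
  simp_rw [itoIsometry_simple_holds _ t]
  refine tendsto_integral_of_dominated_convergence (fun ω ↦ t * M ω ^ 2)
    (fun n ↦ (integrable_setIntegral_toProcess_sq _ t).aestronglyMeasurable)
    (hM2.integrable_sq.const_mul _) (fun n ↦ ?_) ?_
  · filter_upwards [hMb] with ω hω
    have hM : 0 ≤ M ω := (abs_nonneg _).trans (hω 0 zero_le)
    rw [Real.norm_eq_abs, abs_of_nonneg (integral_nonneg fun s ↦ sq_nonneg _)]
    calc ∫ s in Set.Icc (0 : ℝ) t, ((SimpleProcess.sample σ hσa n).toProcess s.toNNReal ω) ^ 2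
        ≤ ∫ _ in Set.Icc (0 : ℝ) t, M ω ^ 2 := by
          have hpt : ∀ s ∈ Set.Icc (0 : ℝ) t,
              ((SimpleProcess.sample σ hσa n).toProcess s.toNNReal ω) ^ 2 ≤ M ω ^ 2 := by
            intro s hs
            have h := abs_toProcess_sample_le_of_bound hσa (n := n) hM hω
              (Real.toNNReal_le_iff_le_coe.2 hs.2)
            nlinarith [abs_nonneg ((SimpleProcess.sample σ hσa n).toProcess s.toNNReal ω),
              sq_abs ((SimpleProcess.sample σ hσa n).toProcess s.toNNReal ω)]
          have hconst : IntegrableOn (fun _ : ℝ ↦ M ω ^ 2) (Set.Icc (0 : ℝ) t) :=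
            integrableOn_const (hs := measure_Icc_lt_top.ne)
          refine setIntegral_mono_on ?_ hconst measurableSet_Icc hpt
          exact Integrable.mono' hconst
            ((((SimpleProcess.sample σ hσa n).measurable_toProcess_prod.comp
              (measurable_const.prodMk measurable_id))).pow_const 2).aestronglyMeasurable
            ((ae_restrict_iff' measurableSet_Icc).2 (ae_of_all _ fun s hs ↦ by
              rw [Real.norm_eq_abs, abs_of_nonneg (sq_nonneg _)]; exact hpt s hs))
      _ = t * M ω ^ 2 := by
          rw [setIntegral_const, Real.volume_real_Icc_of_le (by positivity), sub_zero, smul_eq_mul]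
  · filter_upwards [hσc, hMb] with ω hω hωb
    exact tendsto_setIntegral_sample_sq hσa hω hωb

/-- **Second-moment bound for the Itô integral of a continuous dominated integrand**: for the
process `J` of `exists_isItoIntegral_of_continuous` — more generally for any a.s. limit at time
`t` of a subsequence of the elementary integrals of the samples — `E[J_t²] ≤ E ∫₀ᵗ σ² ds`
(Fatou). (Equality, the Itô isometry for `J`, also holds; the inequality is what moment estimates
need.)
Revuz–Yor, *Continuous Martingales and Brownian Motion* (1999), Ch. IV, Thm (2.2). [folklore] -/
theorem integral_sq_le_of_tendsto_sample (hσa : Adapted RandomPlanarGeometry.brownianFiltration σ)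
    (hσc : ∀ᵐ ω ∂preWienerMeasure, Continuous (σ · ω))
    (hdom : ∀ t : ℝ≥0, ∃ M : (ℝ≥0 → ℝ) → ℝ, MemLp M 2 preWienerMeasure ∧
      ∀ᵐ ω ∂preWienerMeasure, ∀ s ≤ t, |σ s ω| ≤ M ω) {t : ℝ≥0}
    {Jt : (ℝ≥0 → ℝ) → ℝ} {φ : ℕ → ℕ}
    (hφ : StrictMono φ) (hlim : ∀ᵐ ω ∂preWienerMeasure,
      Tendsto (fun k ↦ (SimpleProcess.sample σ hσa (φ k)).integral brownian t ω) atTop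
        (𝓝 (Jt ω))) :
    ∫⁻ ω, ENNReal.ofReal (Jt ω ^ 2) ∂preWienerMeasure ≤
      ENNReal.ofReal (∫ ω, (∫ s in Set.Icc (0 : ℝ) t, (σ s.toNNReal ω) ^ 2) ∂preWienerMeasure) := by
  set Y : ℕ → (ℝ≥0 → ℝ) → ℝ := fun k ↦ (SimpleProcess.sample σ hσa (φ k)).integral brownian t
    with hY
  have hYL2 : ∀ k, MemLp (Y k) 2 preWienerMeasure := fun k ↦ memLp_two_integral_brownian _ t
  have hliminf : ∀ᵐ ω ∂preWienerMeasure,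
      liminf (fun k ↦ ENNReal.ofReal (Y k ω ^ 2)) atTop = ENNReal.ofReal (Jt ω ^ 2) := by
    filter_upwards [hlim] with ω hω
    exact ((ENNReal.continuous_ofReal.tendsto _).comp
      (((continuous_pow 2).tendsto _).comp hω)).liminf_eq
  have hconv := tendsto_integral_integral_sample_sq hσa hσc hdom t
  calc ∫⁻ ω, ENNReal.ofReal (Jt ω ^ 2) ∂preWienerMeasure
      = ∫⁻ ω, liminf (fun k ↦ ENNReal.ofReal (Y k ω ^ 2)) atTop ∂preWienerMeasure :=
        lintegral_congr_ae (hliminf.mono fun ω hω ↦ hω.symm)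
    _ ≤ liminf (fun k ↦ ∫⁻ ω, ENNReal.ofReal (Y k ω ^ 2) ∂preWienerMeasure) atTop :=
        lintegral_liminf_le' fun k ↦ ((hYL2 k).1.aemeasurable.pow_const 2).ennreal_ofReal
    _ = liminf (fun k ↦ ENNReal.ofReal (∫ ω, Y k ω ^ 2 ∂preWienerMeasure)) atTop := by
        refine liminf_congr (Eventually.of_forall fun k ↦ ?_)
        rw [← ofReal_integral_eq_lintegral_ofReal (hYL2 k).integrable_sq
          (ae_of_all _ fun ω ↦ sq_nonneg _)]
    _ = ENNReal.ofReal (∫ ω, (∫ s in Set.Icc (0 : ℝ) t, (σ s.toNNReal ω) ^ 2)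
          ∂preWienerMeasure) := by
        refine Tendsto.liminf_eq ?_
        exact (ENNReal.continuous_ofReal.tendsto _).comp (hconv.comp hφ.tendsto_atTop)

end Literature.Probability.Process
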